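import Summits.CriticalPhenomena.PercolationContinuityZ3.Theses.PercNonProliferation
import Summits.CriticalPhenomena.PercolationContinuityZ3.Theses.PercBurnResprinkle

/-!
# Sketch — crux-ideate `stmt-CriticalPhenomena-4445` (FreeBoxSparse), round 1, ideator 2

First-lemma signatures (Props only, nothing proved) for the three crux idea cards
`repulsion-depleted-walls`, `self-dilution-territorial-exclusion`, `mass-budget-monokill`.
All constants are existing declarations of the tree (`box`, `zdGraph`, `Site`, `bondPercolation`,
`criticalProbI`, `openConnIn`, `theta`) and the two route decls
`PercNonProliferation.FreeBoxSparse` (the crux, fixed) and `PercBurnResprinkle.UniformDiminishment`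
(item stmt-CriticalPhenomena-7206, leaned on by card 2).
-/

noncomputable section

open MeasureTheory Filter
open scoped Classical
open Literature.Probability.Percolation Literature.Probability.LatticeModels

namespace Summit.CriticalPhenomena.PercolationContinuityZ3.Cruxes.FreeBoxSparse.Ideator2

/-- Critical bond percolation on `ℤ³`. -/
abbrev μc : Measure (BondConfig (Site 3)) := bondPercolation (zdGraph 3) (criticalProbI 3)

/-- `θ* = θ(p_c)`. -/
def thetaC : ℝ := theta (zdGraph 3) 0 (criticalProbI 3)

/-- Size of the FREE PIECE of `x` in `Λ_n = box 3 n`: the vertices joined to `x` by an open path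
inside the box (the in-box cluster; `0` if `x ∉ Λ_n`). -/
def pieceCard (n : ℕ) (ω : BondConfig (Site 3)) (x : Site 3) : ℕ :=
  ((box 3 n).filter fun y => ω ∈ openConnIn (↑(box 3 n) : Set (Site 3)) x y).card

/-- `x`'s free piece is `δ`-dense in `Λ_n`. -/
def IsDensePiece (n : ℕ) (δ : ℝ) (ω : BondConfig (Site 3)) (x : Site 3) : Prop :=
  x ∈ box 3 n ∧ δ * ((box 3 n).card : ℝ) ≤ (pieceCard n ω x : ℝ)

/-- Event: two DISTINCT `δ`-dense free pieces in `Λ_n`. -/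
def twoDensePieces (n : ℕ) (δ : ℝ) : Set (BondConfig (Site 3)) :=
  {ω | ∃ x y : Site 3, IsDensePiece n δ ω x ∧ IsDensePiece n δ ω y ∧
      ω ∉ openConnIn (↑(box 3 n) : Set (Site 3)) x y}

/-- `U` — dense-piece uniqueness at `p_c` (card dense-piece-uniqueness-hub; Easo–Hutchcroft
arXiv:2112.12778 Remark 1.4 records its torus form as open). -/
def DensePieceUniqueness : Prop :=
  ∀ δ : ℝ, 0 < δ → Tendsto (fun n : ℕ => μc.real (twoDensePieces n δ)) atTop (nhds 0)

/-- The known transfer `U ⇒ FreeBoxSparse` (hub Theorem A + `¬FBS ⇒ DP_c`), the common spine of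
all three cards. -/
def UniquenessSuffices : Prop :=
  DensePieceUniqueness →
    Summit.CriticalPhenomena.PercolationContinuityZ3.Theses.PercNonProliferation.FreeBoxSparse

/-! ### Card `repulsion-depleted-walls` -/

/-- Number of ordered pairs `(u,v)` of `Λ_n` at sup-distance `≤ t` lying in DISTINCT `δ`-dense
free pieces ("`t`-kisses" between dense pieces). -/
def kissPairs (n t : ℕ) (δ : ℝ) (ω : BondConfig (Site 3)) : ℕ :=
  ((box 3 n ×ˢ box 3 n).filter fun q =>
      IsDensePiece n δ ω q.1 ∧ IsDensePiece n δ ω q.2 ∧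
        ω ∉ openConnIn (↑(box 3 n) : Set (Site 3)) q.1 q.2 ∧ q.1 - q.2 ∈ box 3 t).card

/-- REPULSION LEMMA (first lemma of card 1; claimed provable now): distinct dense free pieces
kiss at most `K^t n^{3/2}` times in expectation. -/
def RepulsionLemma : Prop :=
  ∀ δ : ℝ, 0 < δ → ∀ t : ℕ, ∃ C : ℝ, ∀ n : ℕ, 1 ≤ n →
    ∫ ω, (kissPairs n t δ ω : ℝ) ∂μc ≤ C * (n : ℝ) ^ (3 / 2 : ℝ)

/-- Pivotal lattice edges of `Λ_n` for the increasing event "some free piece has `≥ s` vertices". -/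
def pivotalEdges (n s : ℕ) (ω : BondConfig (Site 3)) : ℕ :=
  (((box 3 n).sym2).filter fun e =>
      e ∈ (zdGraph 3).edgeSet ∧ (∃ x : Site 3, s ≤ pieceCard n (insert e ω) x) ∧
        ¬ ∃ x : Site 3, s ≤ pieceCard n (ω \ {e}) x).card

/-- UNIVERSAL PIVOTAL BOUND (Russo + Cauchy–Schwarz; Chayes–Chayes–Fisher–Spencer): uniformly in
the threshold `s`, `E_{p_c} #pivotal ≤ C n^{3/2}` — the engine behind the repulsion lemma. -/
def UniversalPivotalBound : Prop :=
  ∃ C : ℝ, ∀ n s : ℕ, 1 ≤ n → ∫ ω, (pivotalEdges n s ω : ℝ) ∂μc ≤ C * (n : ℝ) ^ (3 / 2 : ℝ)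

/-- Joint `R`-density of two distinct dense pieces on a sub-box `z + Λ_ρ ⊆ Λ_n`. -/
def jointlyDense (n R ρ : ℕ) (δ : ℝ) : Set (BondConfig (Site 3)) :=
  {ω | ∃ x y z : Site 3, IsDensePiece n δ ω x ∧ IsDensePiece n δ ω y ∧
      ω ∉ openConnIn (↑(box 3 n) : Set (Site 3)) x y ∧
      (∀ w : Site 3, w - z ∈ box 3 ρ → w ∈ box 3 n) ∧
      (∀ w : Site 3, w - z ∈ box 3 ρ →
          (∃ u : Site 3, u - w ∈ box 3 R ∧ ω ∈ openConnIn (↑(box 3 n) : Set (Site 3)) x u) ∧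
          (∃ v : Site 3, v - w ∈ box 3 R ∧ ω ∈ openConnIn (↑(box 3 n) : Set (Site 3)) y v))}

/-- DEPLETED WALLS (corollary of repulsion): two distinct dense pieces are never both `R`-dense
on a sub-box of side `≥ n^{1/2+κ}`; walls of `U`-failures carry depletion zones. -/
def DepletedWalls : Prop :=
  ∀ δ : ℝ, 0 < δ → ∀ R : ℕ, ∀ κ : ℝ, 0 < κ →
    Tendsto (fun n : ℕ => μc.real (jointlyDense n R ⌈(n : ℝ) ^ (1 / 2 + κ)⌉₊ δ)) atTop (nhds 0)

/-! ### Card `self-dilution-territorial-exclusion` -/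

/-- `x` is joined to sup-distance `> m` by an open path avoiding the deleted set `D`. -/
def farConnAvoiding (D : Set (Site 3)) (x : Site 3) (m : ℕ) : Set (BondConfig (Site 3)) :=
  {ω | ∃ y : Site 3, y - x ∉ box 3 m ∧ ω ∈ openConnIn Dᶜ x y}

/-- UNIFORM DILUTED DECAY at `p_c(ℤ³)`: in the complement of ANY `R`-dense deleted set the critical
parameter of `ℤ³` is uniformly exponentially subcritical (target of: UniformDiminishment + DCT
sharpness for general graphs + compactness of the space of `R`-dense sets). -/
def UniformDilutedDecay : Prop :=
  ∀ R : ℕ, ∃ C κ : ℝ, 0 < κ ∧ ∀ D : Set (Site 3), (∀ x : Site 3, ∃ y ∈ D, y - x ∈ box 3 R) →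
    ∀ x : Site 3, ∀ m : ℕ, μc.real (farConnAvoiding D x m) ≤ C * Real.exp (-κ * m)

/-- First lemma of card 2: the existing support item `PercBurnResprinkle.UniformDiminishment`
(stmt-CriticalPhenomena-7206) upgrades to uniform decay. -/
def DilutedDecayOfDiminishment : Prop :=
  Summit.CriticalPhenomena.PercolationContinuityZ3.Theses.PercBurnResprinkle.UniformDiminishment →
    UniformDilutedDecay

/-- Event: some free piece of `Λ_n` (that of `x`) is `R`-dense on the sub-box `z + Λ_ρ ⊆ Λ_n`, yet
`z` lies in a DIFFERENT free piece which reaches sup-distance `> ρ` from `z` inside `Λ_n`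
(a foreign piece penetrating an `R`-dense territory to depth `ρ`). -/
def foreignAtDepth (n R ρ : ℕ) : Set (BondConfig (Site 3)) :=
  {ω | ∃ x z : Site 3, x ∈ box 3 n ∧ (∀ w : Site 3, w - z ∈ box 3 ρ → w ∈ box 3 n) ∧
      (∀ w : Site 3, w - z ∈ box 3 ρ →
          ∃ u : Site 3, u - w ∈ box 3 R ∧ ω ∈ openConnIn (↑(box 3 n) : Set (Site 3)) x u) ∧
      ω ∉ openConnIn (↑(box 3 n) : Set (Site 3)) x z ∧
      ∃ z' : Site 3, z' - z ∉ box 3 ρ ∧ ω ∈ openConnIn (↑(box 3 n) : Set (Site 3)) z z'}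

/-- TERRITORIAL EXCLUSION (self-dilution: spatial Markov property of an explored piece + uniform
diluted decay + union bound): foreign pieces penetrate `R`-dense territories only `C_R log n` deep. -/
def TerritorialExclusion : Prop :=
  ∀ R : ℕ, ∃ C : ℝ, Tendsto (fun n : ℕ => μc.real (foreignAtDepth n R ⌈C * Real.log n⌉₊)) atTop (nhds 0)

def ExclusionOfDecay : Prop := UniformDilutedDecay → TerritorialExclusion

/-! ### Card `mass-budget-monokill` -/

/-- Near-monolithic free box: some free piece captures all but `ε|Λ_n|` of the density `θ*`. -/
def nearMono (n : ℕ) (ε : ℝ) : Set (BondConfig (Site 3)) :=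
  {ω | ∃ x : Site 3, x ∈ box 3 n ∧ (thetaC - ε) * ((box 3 n).card : ℝ) ≤ (pieceCard n ω x : ℝ)}

/-- MONOKILL / FREE BOXES LOSE MASS (claimed provable now from hub Theorem A + mass budget): at
`p_c`, free boxes cannot be near-monolithic with probability `≥ 1 - ε₀` at two consecutive dyadic
scales; `ε₀` is the Liggett–Schonmann–Stacey constant for 4-dependent site fields on `ℤ³`.
(Vacuous when `θ* = 0`; in a jump world it is an unconditional mass defect.) -/
def FreeBoxesLoseMass : Prop :=
  ∃ ε₀ : ℝ, 0 < ε₀ ∧ ∀ ε : ℝ, 0 < ε → 19 * ε < thetaC →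
    ∀ᶠ n : ℕ in atTop, μc.real (nearMono n ε) < 1 - ε₀ ∨ μc.real (nearMono (2 * n) ε) < 1 - ε₀

/-- The mass-budget step: near-monolithic boxes have dense-piece uniqueness for free (a second
`(θ*-ε)/9`-dense piece overdraws the budget `|I ∩ Λ_n| ≤ (θ*+ε)|Λ_n|` w.h.p.). -/
def MassBudgetUniqueness : Prop :=
  ∀ ε η : ℝ, 0 < ε → 19 * ε < thetaC → 0 < η → ∀ᶠ n : ℕ in atTop,
    μc.real (nearMono n ε ∩ twoDensePieces n ((thetaC - ε) / 9)) < η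

end Summit.CriticalPhenomena.PercolationContinuityZ3.Cruxes.FreeBoxSparse.Ideator2
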